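import Literature.AlgebraicGeometry.Modules.SheafHomCurry
import HarnessLib

/-!
# Evaluation and section formulas for the internal curry `𝓗om(B₁ ⊗ B₂, C) ≅ 𝓗om(B₂, 𝓗om(B₁, C))` (Stacks 01CN)

Layer `Literature/AlgebraicGeometry/Modules` (0 definitions, 0 named facts, no instances, no notation). The internal curry
`sheafHomCurryIso B₁ B₂ C` of `Modules/SheafHomCurry` (The Stacks Project, Tag 01CN: "There is a canonical isomorphism
`𝓗om(𝓕 ⊗ 𝓖, 𝓗) → 𝓗om(𝓕, 𝓗om(𝓖, 𝓗))` which is functorial in all three entries"; Görtz–Wedhorn I (7.4.7)) was constructed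
there by the Yoneda principle and characterised by `comp_sheafHomCurryIso_hom` (composition curries) and
`sheafHomCurryIso_hom_naturality`. This file proves the two formulas a user computes with:

* **`tensorMap_sheafHomCurryIso_inv_comp_counit`** — the EVALUATION FORMULA: uncurrying followed by the evaluation
  `(B₁ ⊗ B₂) ⊗ 𝓗om(B₁ ⊗ B₂, C) → C` is the iterated evaluation
  `(B₁ ⊗ B₂) ⊗ 𝓗om(B₂, 𝓗om(B₁, C)) ≅ B₁ ⊗ (B₂ ⊗ 𝓗om(B₂, 𝓗om(B₁, C))) → B₁ ⊗ 𝓗om(B₁, C) → C`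
  (`tensorSheafHomCounit` of `Modules/TensorSheafHomAdjunction`, `tensorAssoc` of `Modules/TensorAssociator`), and the same
  with the curry on the other side, **`tensorMap_sheafHomCurryIso_hom_comp_eval`**;
* **`appLE_sheafHomCurryIso_inv_app_tmulSection`** — the SECTION FORMULA on elementary tensors: for a section
  `s ∈ Γ(U, 𝓗om(B₂, 𝓗om(B₁, C)))` (a morphism `B₂|_U → 𝓗om(B₁, C)|_U`) and sections `b₁ ∈ Γ(U, B₁)`, `b₂ ∈ Γ(U, B₂)`,
  the uncurried section `curry⁻¹(s) : (B₁ ⊗ B₂)|_U → C|_U` satisfies `curry⁻¹(s)(b₁ ⊗ b₂) = (s(b₂))(b₁)` — Stacks 01CN's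
  description "sections of `𝓗om(𝓕 ⊗ 𝓖, 𝓗)` over `U` ↔ bilinear rules `(b₁, b₂) ↦ …`".

Everything is proved from the (C-1) file's `sheafHomCurryIso_inv` / `uncurryHom` and the section formulas of the adjunction
(`tensorSheafHomEquiv_symm_apply`, `tensorSheafHomCounit_app_tmulSection`, `tensorMap_app_tmulSection`,
`tensorAssoc_hom_app_tmulSection`); no named fact. Library only (cell `pub-hodge-ring2`, count-neutral; proves nothing about
any crux, route or conjecture).

## References

* The Stacks Project, Tag 01CN (Lemma 17.22.3, internal hom and tensor), Tag 01CA. [StacksProject]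
* U. Görtz, T. Wedhorn, *Algebraic Geometry I*, 2nd ed. (2020), (7.4.7), Prop. 7.7. [GortzWedhorn2020]
* R. Hartshorne, *Algebraic Geometry* (1977), II Ex. 5.1 (c). [Hartshorne1977]
-/

noncomputable section

set_option backward.isDefEq.respectTransparency false -- `Scheme.Modules` is not reducible (as in Mathlib)

open CategoryTheory AlgebraicGeometry Opposite

universe u

namespace Literature.AlgebraicGeometry.Modules

variable {X : Scheme.{u}} (B₁ B₂ C : X.Modules)

/-- **Evaluation formula for the internal curry** (uncurry side): `(𝟙 ⊗ curry⁻¹) ≫ ev_{B₁ ⊗ B₂} = α ≫ (𝟙_{B₁} ⊗ ev_{B₂})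
≫ ev_{B₁}` as morphisms `(B₁ ⊗ B₂) ⊗ 𝓗om(B₂, 𝓗om(B₁, C)) ⟶ C`. [cite: StacksProject, Tag 01CN] [cite: GortzWedhorn2020, (7.4.7)] -/
theorem tensorMap_sheafHomCurryIso_inv_comp_counit :
    tensorMap (𝟙 (tensorObj B₁ B₂)) (sheafHomCurryIso B₁ B₂ C).inv ≫ tensorSheafHomCounit (tensorObj B₁ B₂) C =
      (tensorAssoc B₁ B₂ (sheafHom B₂ (sheafHom B₁ C))).hom ≫
        tensorMap (𝟙 B₁) (tensorSheafHomCounit B₂ (sheafHom B₁ C)) ≫ tensorSheafHomCounit B₁ C := by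
  rw [← tensorSheafHomEquiv_symm_apply, sheafHomCurryIso_inv, uncurryHom, Equiv.symm_apply_apply,
    tensorSheafHomEquiv_symm_apply, tensorSheafHomEquiv_symm_apply, tensorMap_id, Category.id_comp]

/-- **Evaluation formula for the internal curry** (curry side): `(𝟙 ⊗ curry) ≫ α ≫ (𝟙_{B₁} ⊗ ev_{B₂}) ≫ ev_{B₁} =
ev_{B₁ ⊗ B₂}` as morphisms `(B₁ ⊗ B₂) ⊗ 𝓗om(B₁ ⊗ B₂, C) ⟶ C` — evaluating a curried local homomorphism twice is evaluating
the original one. [cite: StacksProject, Tag 01CN] [cite: GortzWedhorn2020, (7.4.7)] -/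
theorem tensorMap_sheafHomCurryIso_hom_comp_eval :
    tensorMap (𝟙 (tensorObj B₁ B₂)) (sheafHomCurryIso B₁ B₂ C).hom ≫
        (tensorAssoc B₁ B₂ (sheafHom B₂ (sheafHom B₁ C))).hom ≫
          tensorMap (𝟙 B₁) (tensorSheafHomCounit B₂ (sheafHom B₁ C)) ≫ tensorSheafHomCounit B₁ C =
      tensorSheafHomCounit (tensorObj B₁ B₂) C := by
  rw [← tensorMap_sheafHomCurryIso_inv_comp_counit, ← Category.assoc, ← tensorMap_comp, Category.comp_id,
    Iso.hom_inv_id, tensorMap_id, Category.id_comp]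

variable {B₁ B₂ C}

/-- **Section formula for the internal curry on elementary tensors**: for a section `s` of `𝓗om(B₂, 𝓗om(B₁, C))` over `U`
(a morphism `B₂|_U ⟶ 𝓗om(B₁, C)|_U`) and sections `b₁ ∈ Γ(U, B₁)`, `b₂ ∈ Γ(U, B₂)`, the uncurried section
`curry⁻¹(s) : (B₁ ⊗ B₂)|_U ⟶ C|_U` sends `b₁ ⊗ b₂` to `(s(b₂))(b₁)`. [cite: StacksProject, Tag 01CN] [cite: Hartshorne1977, II Ex. 5.1 (c)] -/
theorem appLE_sheafHomCurryIso_inv_app_tmulSection (U : X.Opens) (s : B₂.over U ⟶ (sheafHom B₁ C).over U)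
    (b₁ : secMod B₁ U) (b₂ : secMod B₂ U) :
    appLE (((sheafHomCurryIso B₁ B₂ C).inv.app U (s : Γ(sheafHom B₂ (sheafHom B₁ C), U)) :
        (tensorObj B₁ B₂).over U ⟶ C.over U)) (𝟙 U) (tmulSection B₁ B₂ U b₁ b₂) =
      appLE ((appLE s (𝟙 U) b₂ : Γ(sheafHom B₁ C, U)) : B₁.over U ⟶ C.over U) (𝟙 U) b₁ := by
  have h := congrArg (fun φ => φ.app U (tmulSection (tensorObj B₁ B₂) (sheafHom B₂ (sheafHom B₁ C)) U
    (tmulSection B₁ B₂ U b₁ b₂) (s : Γ(sheafHom B₂ (sheafHom B₁ C), U))))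
    (tensorMap_sheafHomCurryIso_inv_comp_counit B₁ B₂ C)
  simp only [Scheme.Modules.Hom.comp_app, CategoryTheory.comp_apply, tensorMap_app_tmulSection,
    Scheme.Modules.Hom.id_app, CategoryTheory.id_apply, tensorAssoc_hom_app_tmulSection] at h
  rw [tensorSheafHomCounit_app_tmulSection] at h
  rw [h]
  -- right-hand side: `ev_{B₁}(b₁ ⊗ ev_{B₂}(b₂ ⊗ s)) = (s(b₂))(b₁)`
  have h₂ : (tensorSheafHomCounit B₂ (sheafHom B₁ C)).app U
      (tmulSection B₂ (sheafHom B₂ (sheafHom B₁ C)) U b₂ (s : Γ(sheafHom B₂ (sheafHom B₁ C), U))) =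
        appLE s (𝟙 U) b₂ :=
    tensorSheafHomCounit_app_tmulSection B₂ (sheafHom B₁ C) U b₂ s
  rw [h₂]
  exact tensorSheafHomCounit_app_tmulSection B₁ C U b₁ _

end Literature.AlgebraicGeometry.Modules

end
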